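import Literature.AnabelianGeometry.SemiGraphs.Coverticial
import Literature.AnabelianGeometry.SemiGraphs.EdgeAlignedStabilizers
import Literature.AnabelianGeometry.SemiGraphs.LevelEdgesOfObject
import Literature.AnabelianGeometry.SemiGraphs.ComponentsReadBack
import Literature.AnabelianGeometry.SemiGraphs.GraphCoveringDegreeOne
import Literature.AnabelianGeometry.Anabelioids.FibreRangeSubobjects

/-!
# Stars of a finite étale covering, counted through the local clause ([SemiAnbd] Def. 2.2 (i) p. 23)

Mochizuki, *Semi-graphs of anabelioids*, Publ. RIMS **42** (2006) 221–322, §2, Def. 2.2 (i) p. 23: for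
the finite étale covering `ℋ → 𝒦` attached to `A ∈ B(𝒦)`, "the edges `e′` of `𝔾′` are the connected
components of `B′ ×_B 𝒢_e`", a branch of such an edge over `b` abutting to the vertex of the component
`P ⊆ A_u` under which it lies via `ψ_b` [cite: MochizukiSemiAnbd2006, Def. 2.2(i) p.23].

PROOF-ONLY companion (abc-iut cell, layer L3; FACT-LIST row F-1478 `remark_2_4_1_covering`, brick
**(T-δ)** part 3a of `HOME/staging/f/f-161/J1-TIE-ROUTE.md`; seat abc-iut-f-161).  The LOCAL clause
`Hom.IsFiniteEtaleCoveringOf ψ A` (labels `cV`, `cE`, their bijectivity, the branch clause) controls the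
stars of `ℋ`: **the branches at `w` over a branch `b` of `𝕂` are at least as many as the components of
`A_e` lying under ANY component `P ≅ cV w` of `A_u`** — the count feeding `FibreData.isExcision_of_labels`
for the canonical (global) labels, whose vertex label `O(w)` is isomorphic, not equal, to `cV w`
(`TieLabels.nonempty_iso_of_localGlobalSection`).

* `componentOver_eq_iff_le_branchImage` — the component of `A_u` under `Q ⊆ A_e` along `b` is `P` iff
  `Q ⊆ ψ_b(b^* P)`; `sigma_componentOver_eq` (bookkeeping of the abutting vertex);
* `natCard_components_le_mk_eq` — in a Galois category, the number of connected components of `Z` inside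
  a monomorphism `Y ↪ Z` depends only on `Y` (abc-iut-L3 `componentIn`); hence
  `natCard_le_branchImage_eq_of_iso` — isomorphic `P ≅ P′ ⊆ A_u` have equally many components under them;
* `le_branchImage_of_branchClause`, `componentOver_localLabel_eq` — the branch clause of the local
  description, as "the component under `cE(e(b′))` along `ψ b′` is `cV w`";
* `natCard_componentOver_eq_le_natCard_branches` — **`#{Q ⊆ A_e under cV w along b} ≤ #{branches of ℋ
  at w over b}`** (each such `Q` is `cE e′` for an edge `e′` over `e` whose branch over `b` abuts —
  properness — to a vertex labelled, by the branch clause, `cV w`, i.e. to `w`).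

No `def`, no new `Prop`; nothing here takes a side on [IUTchIII] Cor. 3.12.
-/

namespace Literature.AnabelianGeometry.SemiGraphs

open CategoryTheory CategoryTheory.Limits CategoryTheory.PreGaloisCategory
open Literature.AnabelianGeometry.Anabelioids

universe v₁ u₁ u

/-! ### Components inside a monomorphism: the count depends only on the source -/

section Galois

universe v₂ u₂

variable {C : Type u₂} [Category.{v₂} C] [GaloisCategory C]

-- Mathlib's `Over` simp lemmas / `π₀Obj` coercions, as in `ComponentsReadBack`.
set_option backward.isDefEq.respectTransparency false in
/-- **The number of connected components of `Z` lying inside a monomorphism `m : Y ↪ Z` depends only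
on `Y`**: they are named bijectively by the components of `(Y = Y) ∈ C_{/Y}` (abc-iut-L3's
`componentIn` / `componentIn_injective` / `exists_componentIn_eq`). [cite: MochizukiSemiAnbd2006, Def. 2.2(i) p.23] -/
theorem natCard_components_le_mk_eq {Y Z : C} (m : Y ⟶ Z) [Mono m] :
    Nat.card {Q : π₀Obj Z // Q.1 ≤ Subobject.mk m} =
      Nat.card (π₀Obj ((𝟭 (Over Y)).obj (Over.mk (𝟙 Y)))) := by
  refine (Nat.card_congr (Equiv.ofBijective
    (fun K : π₀Obj ((𝟭 (Over Y)).obj (Over.mk (𝟙 Y))) =>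
      (⟨componentIn (𝟭 (Over Y)) (Over.mk (𝟙 Y)) m K,
        componentIn_le (𝟭 (Over Y)) (Over.mk (𝟙 Y)) m K⟩ : {Q : π₀Obj Z // Q.1 ≤ Subobject.mk m}))
    ⟨fun K₁ K₂ h => componentIn_injective (𝟭 (Over Y)) (Over.mk (𝟙 Y)) m (congrArg Subtype.val h),
      fun Q => ?_⟩)).symm
  obtain ⟨K, hK⟩ := exists_componentIn_eq (𝟭 (Over Y)) (Over.mk (𝟙 Y)) m Q.1 Q.2
  exact ⟨K, Subtype.ext hK⟩

/-- Hence two monomorphisms with isomorphic sources contain equally many components of `Z`.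
[cite: MochizukiSemiAnbd2006, Def. 2.2(i) p.23] -/
theorem natCard_components_le_mk_eq_of_iso {Y Y' Z : C} (m : Y ⟶ Z) [Mono m] (m' : Y' ⟶ Z) [Mono m']
    (i : Y ≅ Y') :
    Nat.card {Q : π₀Obj Z // Q.1 ≤ Subobject.mk m} = Nat.card {Q : π₀Obj Z // Q.1 ≤ Subobject.mk m'} := by
  haveI : Mono (i.hom ≫ m') := mono_comp _ _
  have h : Subobject.mk m' = Subobject.mk (i.hom ≫ m') :=
    (Subobject.mk_eq_mk_of_comm (i.hom ≫ m') m' i rfl).symm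
  rw [h, natCard_components_le_mk_eq m, natCard_components_le_mk_eq (i.hom ≫ m')]

end Galois

namespace SemiGraphOfAnabelioids

variable {ℋ 𝒦 : SemiGraphOfAnabelioids.{v₁, u₁, u}}

/-! ### The component under a component, as an order condition -/

namespace BObj

variable (A : 𝒦.BObj)

/-- **The component of `S_v` under `Q ⊆ T_e` along `b` is `P` iff `Q ⊆ ψ_b(b^* P)`** (`componentOver` is
characterised by the order condition: abc-iut-L6-t18 `componentOver_eq_of_mem` read on the fibre functor
`b^* ⋙ F_e`). [cite: MochizukiSemiAnbd2006, Def. 2.2(i) p.23] -/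
theorem componentOver_eq_iff_le_branchImage (b : 𝒦.graph.Branch) (v : 𝒦.graph.Vertex)
    (h : 𝒦.graph.abuts b = some v) (Q : π₀Obj (A.T (𝒦.graph.edgeOf b))) (P : π₀Obj (A.S v)) :
    A.componentOver b v h Q = P ↔ Q.1 ≤ A.branchImage b v h P.1 := by
  constructor
  · rintro rfl
    exact A.le_branchImage_componentOver b v h Q
  · intro hle
    -- fibre functors: `F_e` of `𝒦_e`, `F := b^* ⋙ F_e` of `𝒦_v`, identity frame
    let Fe := GaloisCategory.getFiberFunctor (𝒦.E (𝒦.graph.edgeOf b))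
    let F : 𝒦.V v ⥤ FintypeCat.{v₁} := (𝒦.pull b v h).pullback ⋙ Fe
    haveI : FiberFunctor F := fiberFunctor_comp_of_exact _ Fe
    haveI := Q.2
    obtain ⟨q⟩ := nonempty_fiber_of_isConnected Fe (Q.1 : 𝒦.E (𝒦.graph.edgeOf b))
    -- `F_e(Q) ∋ q` lies in the fibre-image of `ψ_b(b^* P)`
    haveI := A.mono_map_arrow_comp_ψ b v h P.1
    have hq : Fe.map Q.1.arrow q ∈
        Set.range (Fe.map ((𝒦.pull b v h).pullback.map P.1.arrow ≫ (A.ψ b v h).hom)) := by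
      rw [← range_map_mk_arrow Fe]
      obtain ⟨y, hy⟩ : Fe.map Q.1.arrow q ∈ Set.range (Fe.map (Subobject.ofLE _ _ hle ≫
          (A.branchImage b v h P.1).arrow)) := ⟨q, by rw [Subobject.ofLE_arrow]⟩
      rw [Fe.map_comp, FintypeCat.comp_apply] at hy
      exact ⟨_, hy⟩
    obtain ⟨z, hz⟩ := hq
    rw [Fe.map_comp, FintypeCat.comp_apply] at hz
    refine componentOver_eq_of_mem A F b h Fe (Iso.refl F) (x := F.map P.1.arrow z) ⟨q, ?_⟩ ⟨z, rfl⟩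
    rw [← hz]
    rfl

/-- Bookkeeping: the vertex to which `b` abuts is unique, so "the component under `Q` along `b`" read at
two presentations `v₁`, `v₂` of that vertex is one point of `Σ v, π₀(A_v)` (the vertex of `𝔾_A` to
which the branch `(b, Q)` abuts). [cite: MochizukiSemiAnbd2006, Def. 2.2(i) p.23] -/
theorem sigma_componentOver_eq (b : 𝒦.graph.Branch) (v₁ v₂ : 𝒦.graph.Vertex)
    (h₁ : 𝒦.graph.abuts b = some v₁) (h₂ : 𝒦.graph.abuts b = some v₂)
    (Q : π₀Obj (A.T (𝒦.graph.edgeOf b))) :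
    (⟨v₁, A.componentOver b v₁ h₁ Q⟩ : Σ v, π₀Obj (A.S v)) = ⟨v₂, A.componentOver b v₂ h₂ Q⟩ := by
  obtain rfl : v₁ = v₂ := Option.some_injective _ (h₁.symm.trans h₂)
  rfl

/-- **Isomorphic components have equally many components under them**: for `P ≅ P′` (as objects of
`𝒦_v`) connected components of `S_v`, the components of `T_e` inside `ψ_b(b^* P)` and inside `ψ_b(b^* P′)`
are equally many. [cite: MochizukiSemiAnbd2006, Def. 2.2(i) p.23] -/
theorem natCard_le_branchImage_eq_of_iso (b : 𝒦.graph.Branch) (v : 𝒦.graph.Vertex)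
    (h : 𝒦.graph.abuts b = some v) (P P' : π₀Obj (A.S v)) (i : (P.1 : 𝒦.V v) ≅ (P'.1 : 𝒦.V v)) :
    Nat.card {Q : π₀Obj (A.T (𝒦.graph.edgeOf b)) // Q.1 ≤ A.branchImage b v h P.1} =
      Nat.card {Q : π₀Obj (A.T (𝒦.graph.edgeOf b)) // Q.1 ≤ A.branchImage b v h P'.1} := by
  haveI := A.mono_map_arrow_comp_ψ b v h P.1
  haveI := A.mono_map_arrow_comp_ψ b v h P'.1
  exact natCard_components_le_mk_eq_of_iso _ _ ((𝒦.pull b v h).pullback.mapIso i)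

/-! ### The branch clause of the local description, as "the component under" -/

/-- The branch clause of `IsFiniteEtaleCoveringOf`, stated across a re-indexing `h : e₁ = e₂` of edges
by `transportE`, read as an inclusion of subobjects of `T_{e₁}`. [cite: MochizukiSemiAnbd2006, Def. 2.2(i) p.23] -/
theorem le_mk_of_branchClause {e₁ e₂ : 𝒦.graph.Edge} (he : e₁ = e₂) {X : 𝒦.E e₁} (g : X ⟶ A.T e₁)
    [Mono g] (Q : π₀Obj (A.T e₂)) (f : (Q.1 : 𝒦.E e₂) ⟶ (𝒦.transportE he).obj X)
    (hf : f ≫ (𝒦.transportE he).map g ≫ eqToHom (𝒦.transportE_obj_T A he) = Q.1.arrow) :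
    (he.symm ▸ Q : π₀Obj (A.T e₁)).1 ≤ Subobject.mk g := by
  subst he
  refine Subobject.le_mk_of_comm f ?_
  rw [← hf]
  change f ≫ g = f ≫ g ≫ 𝟙 _
  rw [Category.comp_id]

end BObj

namespace Hom

variable (ψ : Hom ℋ 𝒦) (A : 𝒦.BObj)
  (cV : ∀ w : ℋ.graph.Vertex, π₀Obj (A.S (ψ.base.vertexMap w)))
  (cE : ∀ e' : ℋ.graph.Edge, π₀Obj (A.T (ψ.base.edgeMap e')))

/-- **The local labels are compatible with abutment**: under the branch clause of
`IsFiniteEtaleCoveringOf`, for a branch `b′` at `w′` over `b` the component of `A_u` under the edge label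
`cE(e(b′))` (re-indexed to the edge of `b`) along `b` is the vertex label `cV w′`.
[cite: MochizukiSemiAnbd2006, Def. 2.2(i) p.23] -/
theorem componentOver_localLabel_eq
    (hbr : ∀ (b' : ℋ.graph.Branch) (v' : ℋ.graph.Vertex) (h' : ℋ.graph.abuts b' = some v'),
      ∃ f : ((cE (ℋ.graph.edgeOf b')).1 : 𝒦.E (ψ.base.edgeMap (ℋ.graph.edgeOf b'))) ⟶
          (𝒦.transportE (ψ.base.edgeOf_branchMap b')).obj
            ((𝒦.pull (ψ.base.branchMap b') (ψ.base.vertexMap v')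
              (ψ.base.abuts_branchMap b' v' h')).pullback.obj ((cV v').1 : 𝒦.V (ψ.base.vertexMap v'))),
        f ≫ (𝒦.transportE (ψ.base.edgeOf_branchMap b')).map
              ((𝒦.pull _ _ (ψ.base.abuts_branchMap b' v' h')).pullback.map (cV v').1.arrow ≫
                (A.ψ (ψ.base.branchMap b') (ψ.base.vertexMap v') (ψ.base.abuts_branchMap b' v' h')).hom) ≫
            eqToHom (𝒦.transportE_obj_T A (ψ.base.edgeOf_branchMap b')) =
          (cE (ℋ.graph.edgeOf b')).1.arrow)
    (b' : ℋ.graph.Branch) (w' : ℋ.graph.Vertex) (h' : ℋ.graph.abuts b' = some w')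
    (b : 𝒦.graph.Branch) (p : ψ.base.branchMap b' = b) :
    A.componentOver b (ψ.base.vertexMap w') (p ▸ ψ.base.abuts_branchMap b' w' h')
        ((ψ.edgeMap_edgeOf_of_branchMap b' b p) ▸ cE (ℋ.graph.edgeOf b') :
          π₀Obj (A.T (𝒦.graph.edgeOf b))) = cV w' := by
  subst p
  rw [A.componentOver_eq_iff_le_branchImage]
  obtain ⟨f, hf⟩ := hbr b' w' h'
  haveI := A.mono_map_arrow_comp_ψ (ψ.base.branchMap b') (ψ.base.vertexMap w')
    (ψ.base.abuts_branchMap b' w' h') (cV w').1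
  exact A.le_mk_of_branchClause (ψ.base.edgeOf_branchMap b') _ (cE (ℋ.graph.edgeOf b')) f hf

/-- Bookkeeping: the edge label (the edge of `𝔾_A` named by `e′`) read at the edge of `b` does not
depend on the presentation of the edge of the branch. [cite: MochizukiSemiAnbd2006, Def. 2.2(i) p.23] -/
theorem eqRec_localLabel_eq {e'₁ e'₂ : ℋ.graph.Edge} (h12 : e'₁ = e'₂) {e : 𝒦.graph.Edge}
    (h₁ : ψ.base.edgeMap e'₁ = e) (h₂ : ψ.base.edgeMap e'₂ = e) :
    (h₁ ▸ cE e'₁ : π₀Obj (A.T e)) = h₂ ▸ cE e'₂ := by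
  subst h12
  rfl

/-- Bookkeeping: a heterogeneous equality of edge labels (edges of `𝔾_A`) is an equality after
re-indexing. [cite: MochizukiSemiAnbd2006, Def. 2.2(i) p.23] -/
theorem eqRec_localLabel_eq_of_heq {e' : ℋ.graph.Edge} {e : 𝒦.graph.Edge} (h : ψ.base.edgeMap e' = e)
    {c : π₀Obj (A.T e)} (hc : HEq (cE e') c) : (h ▸ cE e' : π₀Obj (A.T e)) = c := by
  subst h
  exact eq_of_heq hc

/-- **The edges over `e` are the components of `A_e`** (the edge clause of the local description), as
an equivalence of the fibre of `ψ` over `e` with `π₀(A_e)`. [cite: MochizukiSemiAnbd2006, Def. 2.2(i) p.23] -/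
theorem nonempty_edgeFiber_equiv_π₀Obj
    (hcE : Function.Bijective fun e' : ℋ.graph.Edge => (⟨ψ.base.edgeMap e', cE e'⟩ : Σ e, π₀Obj (A.T e)))
    (e : 𝒦.graph.Edge) :
    ∃ E : ψ.base.EdgeFiber e ≃ π₀Obj (A.T e), ∀ e', E e' = (e'.2 ▸ cE e'.1 : π₀Obj (A.T e)) := by
  let Φ := Equiv.ofBijective _ hcE
  refine ⟨{ toFun := fun e' => (e'.2 ▸ cE e'.1 : π₀Obj (A.T e))
            invFun := fun c => ⟨Φ.symm ⟨e, c⟩, ?_⟩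
            left_inv := fun e' => ?_
            right_inv := fun c => ?_ }, fun _ => rfl⟩
  · have h := Φ.apply_symm_apply ⟨e, c⟩
    exact congrArg Sigma.fst h
  · apply Subtype.ext
    change Φ.symm ⟨e, _⟩ = e'.1
    rw [Equiv.symm_apply_eq]
    change _ = (⟨ψ.base.edgeMap e'.1, cE e'.1⟩ : Σ e, π₀Obj (A.T e))
    obtain ⟨e', rfl⟩ := e'
    rfl
  · have h := Φ.apply_symm_apply ⟨e, c⟩
    change (⟨ψ.base.edgeMap (Φ.symm ⟨e, c⟩), cE (Φ.symm ⟨e, c⟩)⟩ : Σ e, π₀Obj (A.T e)) = ⟨e, c⟩ at h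
    exact eqRec_localLabel_eq_of_heq ψ A cE _ (Sigma.mk.inj_iff.mp h).2

/-- **The star count from the local clause.**  Let `ψ : ℋ → 𝒦` lie over a proper morphism and carry the
local description of the covering attached to `A` (labels `cV`, `cE`: `w ↦ (ψ w, cV w)` injective,
`e′ ↦ (ψ e′, cE e′)` bijective, branch clause).  Then for a vertex `w` and a branch `b` of `𝕂` at `ψ w`,
the components `Q ⊆ A_{e(b)}` whose component under along `b` is `cV w` are at most as many as the
branches of `ℋ` at `w` over `b`: such a `Q` is `cE e′` for a unique edge `e′` over `e(b)`, whose branch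
over `b` abuts (properness) to a vertex `w′` over `ψ w` with `cV w′ =` the component under `Q` (branch
clause), i.e. to `w′ = w`. [cite: MochizukiSemiAnbd2006, Def. 2.2(i) p.23] -/
theorem natCard_componentOver_eq_le_natCard_branches (hprop : SemiGraph.IsProper ψ.base)
    (hcV : Function.Injective fun (w : ℋ.graph.Vertex) =>
      (⟨ψ.base.vertexMap w, cV w⟩ : Σ v, π₀Obj (A.S v)))
    (hcE : Function.Bijective fun e' : ℋ.graph.Edge => (⟨ψ.base.edgeMap e', cE e'⟩ : Σ e, π₀Obj (A.T e)))
    (hbr : ∀ (b' : ℋ.graph.Branch) (v' : ℋ.graph.Vertex) (h' : ℋ.graph.abuts b' = some v'),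
      ∃ f : ((cE (ℋ.graph.edgeOf b')).1 : 𝒦.E (ψ.base.edgeMap (ℋ.graph.edgeOf b'))) ⟶
          (𝒦.transportE (ψ.base.edgeOf_branchMap b')).obj
            ((𝒦.pull (ψ.base.branchMap b') (ψ.base.vertexMap v')
              (ψ.base.abuts_branchMap b' v' h')).pullback.obj ((cV v').1 : 𝒦.V (ψ.base.vertexMap v'))),
        f ≫ (𝒦.transportE (ψ.base.edgeOf_branchMap b')).map
              ((𝒦.pull _ _ (ψ.base.abuts_branchMap b' v' h')).pullback.map (cV v').1.arrow ≫
                (A.ψ (ψ.base.branchMap b') (ψ.base.vertexMap v') (ψ.base.abuts_branchMap b' v' h')).hom) ≫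
            eqToHom (𝒦.transportE_obj_T A (ψ.base.edgeOf_branchMap b')) =
          (cE (ℋ.graph.edgeOf b')).1.arrow)
    (w : ℋ.graph.Vertex) (b : 𝒦.graph.Branch) (hb : 𝒦.graph.abuts b = some (ψ.base.vertexMap w)) :
    Nat.card {Q : π₀Obj (A.T (𝒦.graph.edgeOf b)) // A.componentOver b (ψ.base.vertexMap w) hb Q = cV w} ≤
      Nat.card {b' : ℋ.graph.Branch // ℋ.graph.abuts b' = some w ∧ ψ.base.branchMap b' = b} := by
  classical
  obtain ⟨E, hE⟩ := nonempty_edgeFiber_equiv_π₀Obj ψ A cE hcE (𝒦.graph.edgeOf b)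
  -- the branches at `w` over `b` form a finite set (they embed into the edges over `e(b)`)
  haveI : Finite {b' : ℋ.graph.Branch // ℋ.graph.abuts b' = some w ∧ ψ.base.branchMap b' = b} :=
    Finite.of_injective (fun b' => E ⟨ℋ.graph.edgeOf b'.1, by
        rw [← ψ.base.edgeOf_branchMap, b'.2.2]⟩)
      (fun b'₁ b'₂ h => Subtype.ext (ψ.base.branchMap_injOn _ _
        (congrArg Subtype.val (E.injective h)) (b'₁.2.2.trans b'₂.2.2.symm)))
  -- the map `Q ↦ branch over b of the edge e′ with cE e′ = Q`
  refine Nat.card_le_card_of_injective (fun Q => ⟨SemiGraph.Hom.branchOver b (E.symm Q.1), ?_, ?_⟩) ?_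
  · -- it abuts to `w`
    obtain ⟨w', hw', hw'u⟩ := hprop.exists_abuts_of_branchMap_eq hb
      (SemiGraph.Hom.branchMap_branchOver b (E.symm Q.1))
    have hloc := componentOver_localLabel_eq ψ A cV cE hbr _ w' hw' b
      (SemiGraph.Hom.branchMap_branchOver b (E.symm Q.1))
    -- the re-indexed edge label of that branch is `Q`
    have hlab : ((ψ.edgeMap_edgeOf_of_branchMap _ b (SemiGraph.Hom.branchMap_branchOver b (E.symm Q.1))) ▸
        cE (ℋ.graph.edgeOf (SemiGraph.Hom.branchOver b (E.symm Q.1))) : π₀Obj (A.T (𝒦.graph.edgeOf b))) =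
        Q.1 := by
      rw [eqRec_localLabel_eq ψ A cE (SemiGraph.Hom.edgeOf_branchOver b (E.symm Q.1)) _ (E.symm Q.1).2,
        ← hE, Equiv.apply_symm_apply]
    rw [hlab] at hloc
    -- so `(ψ w′, cV w′) = (ψ w, cV w)`, `w′ = w`
    have hsig := A.sigma_componentOver_eq b (ψ.base.vertexMap w') (ψ.base.vertexMap w)
      ((SemiGraph.Hom.branchMap_branchOver b (E.symm Q.1)) ▸ ψ.base.abuts_branchMap _ w' hw') hb Q.1
    rw [hloc, Q.2] at hsig
    obtain rfl : w' = w := hcV hsig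
    exact hw'
  · exact SemiGraph.Hom.branchMap_branchOver b (E.symm Q.1)
  · intro Q₁ Q₂ h
    have h1 := congrArg (fun b' : {b' : ℋ.graph.Branch //
        ℋ.graph.abuts b' = some w ∧ ψ.base.branchMap b' = b} => ℋ.graph.edgeOf b'.1) h
    simp only [SemiGraph.Hom.edgeOf_branchOver] at h1
    exact Subtype.ext (E.symm.injective (Subtype.ext h1))

end Hom

end SemiGraphOfAnabelioids

end Literature.AnabelianGeometry.SemiGraphs
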